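import Summits.ABC.IUTFork.Cor312PilotIdelesPrContentLower
import Literature.IUT.LogVolume.TensorPacketShellHull
import HarnessLib

/-!
# IUT REPAIR branch → R-H (D-0079 «local-height» programme), ROUND 2/3 door «G2-CREDIT±»: at the sharp real setting of
# record THE CELL SLACK *IS* THE WEIGHTED EXACT-U2 MARGIN — `σ_{i+1,p} = Σ_{v⃗} Pr(v⃗)·(−m(v⃗)·log p + Σ_a log‖c^out(v_a)‖ − log‖t_{q,v_j}‖)`

PROOF-ONLY file (D-0012: 0 definitions, 0 `Prop` facts, no instance) of the abc-iut cell, rung LADDER-ABC:A2.RESCUE.H, seat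
abc-iut-rh-typ-4 (gen 4), answering abc-iut-rh3-gen-2's probe «G2-CREDIT⁺» (HOME/STATUS 2026-08-27T00:22:38Z) BY NAME. TAKES NO
SIDE on [IUTchIII] Cor. 3.12 (S. Mochizuki, *Inter-universal Teichmüller theory III*, kurims manuscript, Cor. 3.12 p. 173 l. 41 –
p. 174 l. 19) or on any author: every statement is an identity between OUR typed objects at ONE instantiation — abc-iut-c312-7's
packet-normalised sharp real setting `Thm311.Real.settingPrVolSharp X …` (Dupuy–Hilado pilot regions read off ideles, SHARP (Ind3)
reading, Dupuy–Hilado-level (Ind1)/(Ind2), trivial archimedean container). typed ≠ proved; instantiated ≠ endorsed.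

THE QUESTION (abc-iut-rh3-gen-2, GEN2-CANDIDATES §3). Write `σ_{j,v_ℚ} := logvol(ⁿ˒°𝒰_{j,v_ℚ}) − qLocal_{j,v_ℚ}` for the cell slack
of abc-iut-rp-s2's `ObstructionSS28Window` (`Statement ↔ 0 ≤ PN Σᶠ σ`, `statement_iff_avg_cellSlack`). A licence cell
(`q-region ⊆ ⁿ˒°𝒰`) gives `σ ≥ 0` (`cellSlack_nonneg_of_licenceAt`). Does a cell realised WITH MARGIN `r ≥ 0` (abc-iut-w4-d036's
exact (xi-f) cell `licence_settingPrVolSharp_iff_shellRadii`, p460046) give `σ ≥ c·r` («room»), or only `σ ≥ 0` («membership»)?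

THE ANSWER: «room», WITH EQUALITY, for BOTH signs of the margin. Three landed closed forms are subtracted:
* abc-iut-s2-p7 `Thm311.Real.thetaLocal_settingPrVolSharp_eq_sum_content_hull` (`Cor312PilotIdelesPrContentLower`): for EVERY pilot
  data `X` over any number field, non-zero Θ-ideles `t` (units off `S`) and `q`-ideles `tq`,
  `−|log(Θ)|_{i+1,p} = Σ_{v⃗} Pr(v⃗)·(−m(v⃗)·log p + log μ̄_{v⃗}(hull(log_p(R_{v⃗}^×))))`, `m(v⃗)` the exact CONTENT of the slot union;
* abc-iut-c312-5 `Literature.IUT.LogVolume.packetLogμ_packetHull_logPacket_eq_sum` (`TensorPacketShellHull`):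
  `log μ̄(hull(log_p(R_I^×))) = Σ_a log‖z_a^max‖` for any family of max-norm elements `z_a ∈ log_p(𝒪^×_{k_a})` — abc-iut-c312-5's
  OUTER-RADIUS binder `cout` (`houtΛ`/`hdom`); the hull `hull(p^m·log_p(R_I^×)) = (p^m·⊗c^out)·(R_I)^∼` is a PRINCIPAL BOX
  (`packetHull_zpow_smul_logPacket_eq`, `TensorPacketLicenceExact` §6);
* abc-iut-c312-7 `Thm311.Real.logvol_qRegion_Pr_inr` (`Cor312PilotIdelesPr`): `qLocal_{j,p} = Σ_{v⃗} Pr(v⃗)·log‖t_{q,v_j}‖`.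

CONTENTS (namespace `Summit.ABC.IUTFork.Repair.RHCellSlackExact`; `j = i+1 ∈ 𝔽_l^⋇`, `p` a prime, `v⃗ = e` a tuple of places over `p`):
* §1 `thetaLocal_settingPrVolSharp_eq_sum_content_outer` — `−|log(Θ)|_{i+1,p} = ↑Σ_e Pr(e)·(−m(e)·log p + Σ_a log‖cout(e_a)‖)`;
  `logvol_thetaHull_settingPrVolSharp_eq_sum_content_outer` — the same for the real number `logvol(ⁿ˒°𝒰_{i+1,p})` (`HullDefined` from
  abc-iut-c312-7's `thetaFinite_settingPrVolSharp`).
* §2 `qLocal_settingPrVolSharp_inr_eq_sum` — `qLocal_{j,p} = Σ_e Pr(e)·log‖t_{q,e_j}‖` at the sharp setting (abc-iut-c312-7's closed form).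
* §3 **`cellSlack_settingPrVolSharp_eq`** — THE IDENTITY
  `logvol(ⁿ˒°𝒰_{i+1,p}) − qLocal_{i+1,p} = Σ_e Pr(e)·(−m(e)·log p + Σ_a log‖cout(e_a)‖ − log‖t_{q,e_{i+1}}‖)`.
  READING: with `‖t_q‖ = p^{−v_p(t_q)}` and `‖cout_a‖ = p^{−β_a}` the summand is `(log p)·μ(e)`, `μ(e) := v_p(t_{q,e_j}) − Σ_a β(e_a) − m(e)`,
  and `μ(e) ≥ 0` is EXACTLY the summand's (xi-f) inclusion (abc-iut-c312-5 `iota_smul_subset_packetHull_orbit_iota_smul_iff`: `m(e)` is the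
  largest admissible `m` of its antecedent). At the diagonal packet of one completion `K_w`, `e_w·μ = marg(w,j)` — the R-W table's integer
  `m_q − [e_w·⌊(j²m_q − j·δ_w − (j+1)R_in)/e_w⌋ + (j+1)·R_out]`.
* §4 CREDIT± as inequalities in the licence cell's own shape: `sum_margin_mul_log_le_cellSlack_settingPrVolSharp` — if every tuple's q-box
  has ROOM `p^{m(e)}·‖t_{q,e_j}‖·p^{r(e)} ≤ ∏_a ‖cout(e_a)‖` (`r(e) ∈ ℤ`, any sign), then `(Σ_e Pr(e)·r(e))·log p ≤ σ_{i+1,p}`;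
  `cellSlack_settingPrVolSharp_le_sum_margin_mul_log` — the reverse bound from `∏_a ‖cout(e_a)‖ ≤ p^{m(e)}·‖t_{q,e_j}‖·p^{r(e)}`.
  So a realised cell certifies ROOM, not membership only: G2-CREDIT⁺ (`r ≥ 0 ⟹ σ ≥ +c·r`) and G2-CREDIT⁻ (`r < 0 ⟹ σ ≥ −c·|r|`) are the
  two signs of §3.

HONEST SCOPE. Per PACKET `(j,p)` (a Pr-weighted sum over tuples); the split per PLACE `w` is exact only where all places of the field
over `p` carry isometric completions and equal pilot orders (Galois descent, abc-iut-s2's `Cor312ThetaSideGaloisDescent`); on fibres with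
several local types the mixed tuples carry their own `m(e)` (content read at the tuple's SHALLOWEST Θ-slot) and radii. The identity is
exact for the KERNEL binders (`cout` = max-norm element of `log_p(𝒪^×)`; `m` = exact content); whether a numerical table's columns are these
is that table's audit, not this file's. Nothing here decides any cell at genuine data, asserts or denies Cor. 3.12, or bears on the printed
GLOBAL inequality. [claim: Mochizuki2012, status: disputed] for every quoted construction; [cite: DupuyHilado2025, §3.6, §3.7, §3.9, §4.9,
§4.12]; [cite: Mochizuki2012, IUTchIII Cor. 3.12 p. 173–175, Thm. 3.11 (i) (Ind1)(Ind2) p. 154; IUTchIV Prop. 1.2 (i) p. 10, Prop. 1.4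
(iii) p. 13–14, Thm. 1.10 Step (v) p. 27–28]. Axioms: standard.
-/

noncomputable section

open Set Function NumberField IsDedekindDomain
open scoped Pointwise

namespace Summit.ABC.IUTFork.Repair.RHCellSlackExact

open Thm311 Thm311.Real Cor312 Cor312Vol Literature.IUT.LogThetaLattice Literature.IUT.LogVolume

variable {F : Type} [Field F] [NumberField F] (X : PilotData F) {logv : PadicLogs F} (hlog : LogvAnalytic logv)
  (M : Type) [Field M] [NumberField M]
  (archPk : ∀ (j : (thetaIndex X).Label) (vQ : (thetaIndex X).VQ), Set ((logShellsDH X logv).Packet j vQ))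
  (archSub : ∀ (j : (thetaIndex X).Label) (v : (thetaIndex X).V),
    Set ((logShellsDH X logv).Packet j ((thetaIndex X).over v)))
  (Ψ : ℤ → ∀ v : (thetaIndex X).V, v ∈ (thetaIndex X).Vbad → Set ((logShellsDH X logv).StarPacket v))
  (act : ℤ → ∀ v : (thetaIndex X).V, v ∈ (thetaIndex X).Vbad →
    (logShellsDH X logv).StarPacket v → Module.End ℚ ((logShellsDH X logv).StarPacket v))
  (Mmod : ℤ → ∀ j : (thetaIndex X).LabelStar, Set ((logShellsDH X logv).GlobalPacket j.1))
  (region : ℤ → ∀ j : (thetaIndex X).LabelStar, FinDivisor M → ∀ vQ : (thetaIndex X).VQ,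
    Set ((logShellsDH X logv).Packet j.1 vQ))
  (n : ℤ) {HT : Type} {LogLink : HT → HT → Type} {IsFull : ∀ {s t : HT}, LogLink s t → Prop}
  (lat : LGPGaussianLogThetaLattice LogLink IsFull)
  {Frd : Type} {IsoF : Frd → Frd → Type} {Ob : Frd → Type} {realify : Frd → Frd} {Strip : Type}
  {IsoS : Strip → Strip → Type} {Mv : ∀ v : (thetaIndex X).V, v ∈ (thetaIndex X).Vbad → Type}
  [∀ v h, Monoid (Mv v h)]
  (sig : GlobalLGPFrobenioidSignature (thetaIndex X).lstar (thetaIndex X).V (· ∈ (thetaIndex X).Vbad)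
    Frd IsoF Ob realify Strip IsoS Mv)
  (split : SplittingMonoids Mv) {ObΔ : Type} {N : ∀ v : (thetaIndex X).V, v ∈ (thetaIndex X).Vbad → Type}
  [∀ v h, Monoid (N v h)] (qData : QPilotData ObΔ N)
  (t : ∀ (pp : Nat.Primes) (_ : Fin X.lstar) (x : (thetaIndex X).Fibre (.inr pp)),
    haveI : Fact (pp : ℕ).Prime := ⟨pp.2⟩; kOf X pp.1 x)
  (tq : ∀ (pp : Nat.Primes) (x : (thetaIndex X).Fibre (.inr pp)), haveI : Fact (pp : ℕ).Prime := ⟨pp.2⟩; kOf X pp.1 x)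
  (ht0 : ∀ pp i x, t pp i x ≠ 0)
  (ht1 : ∀ (pp : Nat.Primes) (i : Fin X.lstar) (x : (thetaIndex X).Fibre (.inr pp)),
    haveI : Fact (pp : ℕ).Prime := ⟨pp.2⟩; placeOf X pp.1 x ∉ X.S → ‖t pp i x‖ = 1)
  (htq0 : ∀ pp x, tq pp x ≠ 0)
  (htq1 : ∀ (pp : Nat.Primes) (x : (thetaIndex X).Fibre (.inr pp)),
    haveI : Fact (pp : ℕ).Prime := ⟨pp.2⟩; placeOf X pp.1 x ∉ X.S → ‖tq pp x‖ = 1)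

/-! ## §1. The Θ-side local term in content / OUTER-RADIUS binders -/

section Theta

variable (i : Fin (thetaIndex X).lstar) (pp : Nat.Primes)
  /- the EXACT content family of the slot unions over `p` (abc-iut-s2-p7's binders `hm0`/`hm1`; it exists,
  `Cor312Vol.exists_content_slotUnion`) -/
  (m : ((thetaIndex X).Caps (Setting.labelSucc i) → (thetaIndex X).Fibre (.inr pp)) → ℤ)
  (hm0 : ∀ e : (thetaIndex X).Caps (Setting.labelSucc i) → (thetaIndex X).Fibre (.inr pp),
    haveI : Fact (pp : ℕ).Prime := ⟨pp.2⟩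
    (⋃ a, iota pp.1 ((presAt X hlog pp).kk e) a (t pp i (e a)) •
        (normalizedPacket pp.1 ((presAt X hlog pp).kk e) : Set ((presAt X hlog pp).X e))) ⊆
      (((pp : ℕ) : ℚ_[pp]) ^ m e) • (logPacket pp.1 ((presAt X hlog pp).kk e) : Set ((presAt X hlog pp).X e)))
  (hm1 : ∀ e : (thetaIndex X).Caps (Setting.labelSucc i) → (thetaIndex X).Fibre (.inr pp),
    haveI : Fact (pp : ℕ).Prime := ⟨pp.2⟩
    ¬ (⋃ a, iota pp.1 ((presAt X hlog pp).kk e) a (t pp i (e a)) •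
        (normalizedPacket pp.1 ((presAt X hlog pp).kk e) : Set ((presAt X hlog pp).X e))) ⊆
      (((pp : ℕ) : ℚ_[pp]) ^ (m e + 1)) • (logPacket pp.1 ((presAt X hlog pp).kk e) : Set ((presAt X hlog pp).X e)))
  /- abc-iut-c312-5's OUTER-RADIUS binder at the places over `p`: `cout x ∈ log_p(𝒪^×_{F_x})` of largest norm -/
  {cout : ∀ x : (thetaIndex X).Fibre (.inr pp), haveI : Fact (pp : ℕ).Prime := ⟨pp.2⟩; (presAt X hlog pp).k x}
  (houtΛ : ∀ x, haveI : Fact (pp : ℕ).Prime := ⟨pp.2⟩; cout x ∈ logUnits ((presAt X hlog pp).k x))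
  (hdom : ∀ x, haveI : Fact (pp : ℕ).Prime := ⟨pp.2⟩; ∀ z ∈ logUnits ((presAt X hlog pp).k x), ‖z‖ ≤ ‖cout x‖)

include ht0 ht1 hm0 hm1 houtΛ hdom in
/-- **The local Θ-volume in content / outer-radius binders**: `−|log(Θ)|_{i+1,p} = ↑Σ_{v⃗} Pr(v⃗)·(−m(v⃗)·log p + Σ_a log‖c^out(v_a)‖)`
at the sharp setting of record, for EVERY pilot data, every non-zero Θ-ideles (units off `S`) and `q`-ideles — abc-iut-s2-p7's
`thetaLocal_settingPrVolSharp_eq_sum_content_hull` with abc-iut-c312-5's `log μ̄(hull(log_p(R_I^×))) = Σ_a log‖z_a^max‖`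
(`packetLogμ_packetHull_logPacket_eq_sum`: the hull of the log-shell lattice is the principal box `(⊗c^out)·(R_I)^∼`).
[cite: DupuyHilado2025, §4.9, §4.12] [cite: Mochizuki2012, IUTchIV Prop. 1.4 (iii) p. 13–14, Thm. 1.10 Step (v) p. 27–28] -/
theorem thetaLocal_settingPrVolSharp_eq_sum_content_outer :
    haveI : Fact (pp : ℕ).Prime := ⟨pp.2⟩
    (settingPrVolSharp X hlog M archPk archSub Ψ act Mmod region n lat sig split qData tq t htq0 htq1).thetaLocal
        (Setting.labelSucc i) (.inr pp) =
      ((∑ e : (presAt X hlog pp).toLocalPieces.E (Setting.labelSucc i),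
          weightPr X pp.1 (Setting.labelSucc i) e * (-(m e * Real.log pp) + ∑ a, Real.log ‖cout (e a)‖) : ℝ) : WithTop ℝ) := by
  haveI : Fact (pp : ℕ).Prime := ⟨pp.2⟩
  haveI : Nonempty ((thetaIndex X).Caps (Setting.labelSucc i)) := ⟨0⟩
  rw [thetaLocal_settingPrVolSharp_eq_sum_content_hull X hlog M archPk archSub Ψ act Mmod region n lat sig split qData t tq htq0
    htq1 ht0 ht1 i pp m hm0 hm1]
  congr 1
  refine Finset.sum_congr rfl fun e _ => ?_
  rw [packetLogμ_packetHull_logPacket_eq_sum pp.1 ((presAt X hlog pp).kk e) (z := fun a => cout (e a))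
    (fun a => houtΛ (e a)) (fun a => hdom (e a))]

include ht0 ht1 in
/-- `HullDefined` at every `(i+1, p)` of the sharp setting of record (from abc-iut-c312-7's `thetaFinite_settingPrVolSharp`: the local
Θ-volume is `≠ ⊤`). [claim: Mochizuki2012, status: disputed] -/
theorem hullDefined_settingPrVolSharp :
    (settingPrVolSharp X hlog M archPk archSub Ψ act Mmod region n lat sig split qData tq t htq0 htq1).HullDefined
      (Setting.labelSucc i) (.inr pp) := by
  have h := (thetaFinite_settingPrVolSharp X hlog M archPk archSub Ψ act Mmod region n lat sig split qData t tq ht0 ht1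
    htq0 htq1).1 i (.inr pp)
  by_contra hnd
  apply h
  unfold Setting.thetaLocal
  rw [if_neg hnd]

include ht0 ht1 hm0 hm1 houtΛ hdom in
/-- **The log-volume of the holomorphic hull `ⁿ˒°𝒰_{i+1,p}` in content / outer-radius binders** (the real number under §1's `↑`):
`logvol(ⁿ˒°𝒰_{i+1,p}) = Σ_{v⃗} Pr(v⃗)·(−m(v⃗)·log p + Σ_a log‖c^out(v_a)‖)`. [cite: DupuyHilado2025, §4.9, §4.12]
[cite: Mochizuki2012, IUTchIV Thm. 1.10 Step (v) p. 27–28] -/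
theorem logvol_thetaHull_settingPrVolSharp_eq_sum_content_outer :
    haveI : Fact (pp : ℕ).Prime := ⟨pp.2⟩
    ((situationPrVol X hlog M archPk archSub Ψ act Mmod region).D n).logvol _ (.inr pp)
        ((settingPrVolSharp X hlog M archPk archSub Ψ act Mmod region n lat sig split qData tq t htq0 htq1).thetaHull
          (Setting.labelSucc i) (.inr pp)) =
      ∑ e : (presAt X hlog pp).toLocalPieces.E (Setting.labelSucc i),
        weightPr X pp.1 (Setting.labelSucc i) e * (-(m e * Real.log pp) + ∑ a, Real.log ‖cout (e a)‖) := by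
  haveI : Fact (pp : ℕ).Prime := ⟨pp.2⟩
  have hHD := hullDefined_settingPrVolSharp X hlog M archPk archSub Ψ act Mmod region n lat sig split qData t tq ht0 ht1 htq0 htq1
    i pp
  have h := thetaLocal_settingPrVolSharp_eq_sum_content_outer X hlog M archPk archSub Ψ act Mmod region n lat sig split qData t tq
    ht0 ht1 htq0 htq1 i pp m hm0 hm1 houtΛ hdom
  unfold Setting.thetaLocal at h
  rw [if_pos hHD, WithTop.coe_inj, settingPrVolSharp_n] at h
  exact h

end Theta

/-! ## §2. The q-side local term -/

/-- **The local q-volume of the sharp setting of record**: `qLocal_{j,p} = Σ_{v⃗} Pr(v⃗)·log‖t_{q,v_j}‖` (abc-iut-c312-7's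
`logvol_qRegion_Pr_inr`; Dupuy–Hilado (3.7) summand by summand, the `q`-idele read at the LAST slot). [cite: DupuyHilado2025, §3.7, §3.9] -/
theorem qLocal_settingPrVolSharp_inr_eq_sum (j : (thetaIndex X).Label) (pp : Nat.Primes) :
    haveI : Fact (pp : ℕ).Prime := ⟨pp.2⟩
    (settingPrVolSharp X hlog M archPk archSub Ψ act Mmod region n lat sig split qData tq t htq0 htq1).qLocal j (.inr pp) =
      ∑ e : (presAt X hlog pp).toLocalPieces.E j, weightPr X pp.1 j e * Real.log ‖tq pp (e (Fin.last _))‖ :=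
  logvol_qRegion_Pr_inr X hlog M archPk archSub Ψ act Mmod region n tq htq0 j pp

/-! ## §3. THE IDENTITY: the cell slack is the weighted exact-U2 margin -/

section Identity

variable (i : Fin (thetaIndex X).lstar) (pp : Nat.Primes)
  (m : ((thetaIndex X).Caps (Setting.labelSucc i) → (thetaIndex X).Fibre (.inr pp)) → ℤ)
  (hm0 : ∀ e : (thetaIndex X).Caps (Setting.labelSucc i) → (thetaIndex X).Fibre (.inr pp),
    haveI : Fact (pp : ℕ).Prime := ⟨pp.2⟩
    (⋃ a, iota pp.1 ((presAt X hlog pp).kk e) a (t pp i (e a)) •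
        (normalizedPacket pp.1 ((presAt X hlog pp).kk e) : Set ((presAt X hlog pp).X e))) ⊆
      (((pp : ℕ) : ℚ_[pp]) ^ m e) • (logPacket pp.1 ((presAt X hlog pp).kk e) : Set ((presAt X hlog pp).X e)))
  (hm1 : ∀ e : (thetaIndex X).Caps (Setting.labelSucc i) → (thetaIndex X).Fibre (.inr pp),
    haveI : Fact (pp : ℕ).Prime := ⟨pp.2⟩
    ¬ (⋃ a, iota pp.1 ((presAt X hlog pp).kk e) a (t pp i (e a)) •
        (normalizedPacket pp.1 ((presAt X hlog pp).kk e) : Set ((presAt X hlog pp).X e))) ⊆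
      (((pp : ℕ) : ℚ_[pp]) ^ (m e + 1)) • (logPacket pp.1 ((presAt X hlog pp).kk e) : Set ((presAt X hlog pp).X e)))
  {cout : ∀ x : (thetaIndex X).Fibre (.inr pp), haveI : Fact (pp : ℕ).Prime := ⟨pp.2⟩; (presAt X hlog pp).k x}
  (houtΛ : ∀ x, haveI : Fact (pp : ℕ).Prime := ⟨pp.2⟩; cout x ∈ logUnits ((presAt X hlog pp).k x))
  (hdom : ∀ x, haveI : Fact (pp : ℕ).Prime := ⟨pp.2⟩; ∀ z ∈ logUnits ((presAt X hlog pp).k x), ‖z‖ ≤ ‖cout x‖)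

include ht0 ht1 hm0 hm1 houtΛ hdom in
/-- **THE CELL SLACK IS THE WEIGHTED EXACT-U2 MARGIN (G2-CREDIT±, with equality).** At the sharp real setting of record, for EVERY
pilot data `X` over any number field, every non-zero Θ-ideles `t` (units off `S`) and `q`-ideles `tq`, every label `j = i+1` and prime `p`:
`logvol(ⁿ˒°𝒰_{i+1,p}) − qLocal_{i+1,p} = Σ_{v⃗} Pr(v⃗)·( −m(v⃗)·log p + Σ_a log‖c^out(v_a)‖ − log‖t_{q,v_{i+1}}‖ )`,
`m(v⃗)` the exact content of the slot union, `c^out` abc-iut-c312-5's outer-radius binder. The bracket is `(log p)·μ(v⃗)` with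
`μ(v⃗) = v_p(t_{q,v_j}) − Σ_a β(v_a) − m(v⃗)` (`‖c^out_a‖ = p^{−β_a}`), and `μ(v⃗) ≥ 0` iff the summand's (xi-f) inclusion holds
(`iota_smul_subset_packetHull_orbit_iota_smul_iff`) — a realised licence cell certifies ROOM, not membership only.
[cite: DupuyHilado2025, §3.7, §3.9, §4.9, §4.12] [cite: Mochizuki2012, IUTchIII Cor. 3.12 p. 173–175; IUTchIV Prop. 1.4 (iii) p. 13–14]
[claim: Mochizuki2012, status: disputed] -/
theorem cellSlack_settingPrVolSharp_eq :
    haveI : Fact (pp : ℕ).Prime := ⟨pp.2⟩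
    ((situationPrVol X hlog M archPk archSub Ψ act Mmod region).D n).logvol _ (.inr pp)
          ((settingPrVolSharp X hlog M archPk archSub Ψ act Mmod region n lat sig split qData tq t htq0 htq1).thetaHull
            (Setting.labelSucc i) (.inr pp)) -
        (settingPrVolSharp X hlog M archPk archSub Ψ act Mmod region n lat sig split qData tq t htq0 htq1).qLocal
          (Setting.labelSucc i) (.inr pp) =
      ∑ e : (presAt X hlog pp).toLocalPieces.E (Setting.labelSucc i),
        weightPr X pp.1 (Setting.labelSucc i) e *
          (-(m e * Real.log pp) + ∑ a, Real.log ‖cout (e a)‖ - Real.log ‖tq pp (e (Fin.last _))‖) := by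
  haveI : Fact (pp : ℕ).Prime := ⟨pp.2⟩
  rw [logvol_thetaHull_settingPrVolSharp_eq_sum_content_outer X hlog M archPk archSub Ψ act Mmod region n lat sig split qData t tq
    ht0 ht1 htq0 htq1 i pp m hm0 hm1 houtΛ hdom,
    qLocal_settingPrVolSharp_inr_eq_sum X hlog M archPk archSub Ψ act Mmod region n lat sig split qData t tq htq0 htq1
      (Setting.labelSucc i) pp, ← Finset.sum_sub_distrib]
  refine Finset.sum_congr rfl fun e _ => ?_
  ring

/-! ## §4. CREDIT± in the licence cell's own shape: room below / above the hull box bounds the slack -/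

include ht0 ht1 hm0 hm1 houtΛ hdom in
/-- **G2-CREDIT (lower): ROOM ⟹ SLACK.** If at every tuple `v⃗` over `p` the `q`-box sits inside the hull box with room `p^{r(v⃗)}`,
i.e. `p^{m(v⃗)}·‖t_{q,v_j}‖·p^{r(v⃗)} ≤ ∏_a ‖c^out(v_a)‖` (`r(v⃗) ∈ ℤ` of ANY sign; `r = 0` is abc-iut-c312-5's cell, `r < 0` a deficit),
then `(Σ_{v⃗} Pr(v⃗)·r(v⃗))·log p ≤ logvol(ⁿ˒°𝒰_{i+1,p}) − qLocal_{i+1,p}`. Both signs of rh3-gen-2's G2-CREDIT± at once.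
[cite: DupuyHilado2025, §4.12] [claim: Mochizuki2012, status: disputed] -/
theorem sum_margin_mul_log_le_cellSlack_settingPrVolSharp
    (r : ((thetaIndex X).Caps (Setting.labelSucc i) → (thetaIndex X).Fibre (.inr pp)) → ℤ)
    (hroom : ∀ e : (thetaIndex X).Caps (Setting.labelSucc i) → (thetaIndex X).Fibre (.inr pp),
      haveI : Fact (pp : ℕ).Prime := ⟨pp.2⟩
      ((pp : ℕ) : ℝ) ^ m e * ‖tq pp (e (Fin.last _))‖ * ((pp : ℕ) : ℝ) ^ r e ≤ ∏ a, ‖cout (e a)‖) :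
    haveI : Fact (pp : ℕ).Prime := ⟨pp.2⟩
    (∑ e : (presAt X hlog pp).toLocalPieces.E (Setting.labelSucc i), weightPr X pp.1 (Setting.labelSucc i) e * r e) *
        Real.log pp ≤
      ((situationPrVol X hlog M archPk archSub Ψ act Mmod region).D n).logvol _ (.inr pp)
          ((settingPrVolSharp X hlog M archPk archSub Ψ act Mmod region n lat sig split qData tq t htq0 htq1).thetaHull
            (Setting.labelSucc i) (.inr pp)) -
        (settingPrVolSharp X hlog M archPk archSub Ψ act Mmod region n lat sig split qData tq t htq0 htq1).qLocal
          (Setting.labelSucc i) (.inr pp) := by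
  haveI : Fact (pp : ℕ).Prime := ⟨pp.2⟩
  have hp0 : (0 : ℝ) < ((pp : ℕ) : ℝ) := by exact_mod_cast pp.2.pos
  rw [cellSlack_settingPrVolSharp_eq X hlog M archPk archSub Ψ act Mmod region n lat sig split qData t tq ht0 ht1 htq0 htq1 i pp m
    hm0 hm1 houtΛ hdom, Finset.sum_mul]
  refine Finset.sum_le_sum fun e _ => ?_
  rw [mul_assoc]
  refine mul_le_mul_of_nonneg_left ?_ (weightPr_nonneg X pp.1 _ e)
  -- take logarithms in `hroom`
  have htq : 0 < ‖tq pp (e (Fin.last _))‖ := norm_pos_iff.mpr (htq0 pp _)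
  have hc0 : ∀ a, 0 < ‖cout (e a)‖ := fun a => norm_pos_of_isMaxOn_logUnits pp.1 _ (hdom (e a))
  have hlhs : 0 < ((pp : ℕ) : ℝ) ^ m e * ‖tq pp (e (Fin.last _))‖ * ((pp : ℕ) : ℝ) ^ r e :=
    mul_pos (mul_pos (zpow_pos hp0 _) htq) (zpow_pos hp0 _)
  have hlog := Real.log_le_log hlhs (hroom e)
  rw [Real.log_mul (mul_pos (zpow_pos hp0 _) htq).ne' (zpow_pos hp0 _).ne', Real.log_mul (zpow_pos hp0 _).ne' htq.ne',
    Real.log_zpow, Real.log_zpow, Real.log_prod (fun a _ => (hc0 a).ne')] at hlog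
  linarith

include ht0 ht1 hm0 hm1 houtΛ hdom in
/-- **G2-CREDIT (upper): NO MORE SLACK THAN ROOM.** If at every tuple `∏_a ‖c^out(v_a)‖ ≤ p^{m(v⃗)}·‖t_{q,v_j}‖·p^{r(v⃗)}`, then
`logvol(ⁿ˒°𝒰_{i+1,p}) − qLocal_{i+1,p} ≤ (Σ_{v⃗} Pr(v⃗)·r(v⃗))·log p` — the typed hull is the principal box, so the slack is never larger
than the margin: a weighted local-data hypothesis in margin currency prices EXACTLY what the volume statement needs, no more.
[cite: DupuyHilado2025, §4.12] [claim: Mochizuki2012, status: disputed] -/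
theorem cellSlack_settingPrVolSharp_le_sum_margin_mul_log
    (r : ((thetaIndex X).Caps (Setting.labelSucc i) → (thetaIndex X).Fibre (.inr pp)) → ℤ)
    (hroom : ∀ e : (thetaIndex X).Caps (Setting.labelSucc i) → (thetaIndex X).Fibre (.inr pp),
      haveI : Fact (pp : ℕ).Prime := ⟨pp.2⟩
      ∏ a, ‖cout (e a)‖ ≤ ((pp : ℕ) : ℝ) ^ m e * ‖tq pp (e (Fin.last _))‖ * ((pp : ℕ) : ℝ) ^ r e) :
    haveI : Fact (pp : ℕ).Prime := ⟨pp.2⟩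
    ((situationPrVol X hlog M archPk archSub Ψ act Mmod region).D n).logvol _ (.inr pp)
          ((settingPrVolSharp X hlog M archPk archSub Ψ act Mmod region n lat sig split qData tq t htq0 htq1).thetaHull
            (Setting.labelSucc i) (.inr pp)) -
        (settingPrVolSharp X hlog M archPk archSub Ψ act Mmod region n lat sig split qData tq t htq0 htq1).qLocal
          (Setting.labelSucc i) (.inr pp) ≤
      (∑ e : (presAt X hlog pp).toLocalPieces.E (Setting.labelSucc i), weightPr X pp.1 (Setting.labelSucc i) e * r e) *
        Real.log pp := by
  haveI : Fact (pp : ℕ).Prime := ⟨pp.2⟩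
  have hp0 : (0 : ℝ) < ((pp : ℕ) : ℝ) := by exact_mod_cast pp.2.pos
  rw [cellSlack_settingPrVolSharp_eq X hlog M archPk archSub Ψ act Mmod region n lat sig split qData t tq ht0 ht1 htq0 htq1 i pp m
    hm0 hm1 houtΛ hdom, Finset.sum_mul]
  refine Finset.sum_le_sum fun e _ => ?_
  rw [mul_assoc]
  refine mul_le_mul_of_nonneg_left ?_ (weightPr_nonneg X pp.1 _ e)
  have htq : 0 < ‖tq pp (e (Fin.last _))‖ := norm_pos_iff.mpr (htq0 pp _)
  have hc0 : ∀ a, 0 < ‖cout (e a)‖ := fun a => norm_pos_of_isMaxOn_logUnits pp.1 _ (hdom (e a))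
  have hlhs : 0 < ∏ a, ‖cout (e a)‖ := Finset.prod_pos fun a _ => hc0 a
  have hlog := Real.log_le_log hlhs (hroom e)
  rw [Real.log_mul (mul_pos (zpow_pos hp0 _) htq).ne' (zpow_pos hp0 _).ne', Real.log_mul (zpow_pos hp0 _).ne' htq.ne',
    Real.log_zpow, Real.log_zpow, Real.log_prod (fun a _ => (hc0 a).ne')] at hlog
  linarith

end Identity

end Summit.ABC.IUTFork.Repair.RHCellSlackExact

end
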